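import Mathlib
import HarnessLib
import Summits.HubbardSuperconductivity.HubbardSuperconductivity.Theorems.KLProgrammePerturbedFermiCurveWindowJetsDefs
import Summits.HubbardSuperconductivity.HubbardSuperconductivity.Theorems.KLProgrammePerturbedFermiCurveTwoFrameJacobian

/-!
# Route `KLProgramme` — the frame's polar JACOBIAN against the free band's on a level window: `|J_K^{(i)}(θ) − J^{(i)}(θ)| ≤ Γ_i`, `i ≤ 2`,
# `Γ_i` explicit and vanishing with the frame's per-order sizes (the `jacPert` of the certified Jacobian-jet bundle, no `t`-tower)

Cell `gate-hubbard-kl`, seat hubbard-kl-k3c3-p3 (g7; row «implicit-function / monotonicity route for μ(n)»); helper for the engine-flow child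
`KLRegimeEngineV17F2` (stmt-HubbardSuperconductivity-20437), stub (C) `stub_twoLeg_curvature`, plan (R47r); c4a-1 C4A-PLAN §15.3 (M-alt): the
`hJjet` hypothesis of the tube tadpole-jet theorem reads `‖∂ⁱ J_K‖ ≤ jacCertG i + jacPert i`, `jacCertG` = the CERTIFIED free-band table
(`FreeBandPolarJets …` / `KlwjCertA`: `G₀, G₁, G₂ = 4.261, 16.43, 392.8` on `klWindowC ± 3/80`), `jacPert i` = THIS module's `Γ_i`.

Setting (the `Frame` section of `…WindowJets`): `B : BandBounds a b`, frame `K` with per-order sizes `‖Dʲ frameShift K‖ ≤ A_j` (`j ≤ 3`),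
`2A₁ < Dt_min`, level `ν` with margins `A₀`; `J θ = u(θ)/∂_tF(θ, u(θ))` the FREE polar Jacobian (`u = bandFermiRadius ν`,
`∂_tF = rayDispersionDt`) and `J_K θ = u_K(θ)/∂_t(ε₀ + δ_K)(u_K(θ)·dir θ)[dir θ]` the frame's (`u_K = perturbedFermiRadius δ_K ν`, `δ_K = −K`;
c4a-1's `levelChartJac` at the level `ν` by `levelChartJac_eq_polarJac`).  Inputs at the angle `θ`: the free sizes `u ≤ U₀`, `|u′| ≤ R₁`,
`|u″| ≤ R₂` (the certified table) and the radius differences `W₁ ≥ |u_K′ − u′|`, `W₂ ≥ |u_K″ − u″|` (`…WindowJets`: `frame_polar_tower_of_window`);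
`W₀ = A₀/(Dt_min − 2A₁)`.  Output (`frame_polarJac_sub_free_le`): the three differences with
`ρ₀ = Dt_min − 2A₁`, `E₁ = 4 + 2A₁`, `E₂ = 4 + 4A₂`, `E₃ = 4 + 8A₃`, `Δ₁ = 4W₀ + 2A₁`, `Δ₂ = 4W₀ + 4A₂`, `Δ₃ = 4W₀ + 8A₃`, common radius
sizes `U₀ + W₀`, `R₁ + W₁`, `R₂ + W₂` in `…TwoFrameJacobian`'s `abs_polarJac_sub_le` / `abs_deriv_polarJac_sub_le` / `abs_deriv_two_polarJac_sub_le`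
— every term carries a factor `W₀, W₁, W₂, A₁, A₂` or `A₃`, so `Γ_i → 0` with the frame (for a flow frame at scale `n ≤ 3`, `Γ_i = O(U)`).

Everything is PROVED; no definitions; nothing about the Hubbard model beyond `ε₀`.  References: BGM 2006 §2.4 Lemma 2.1 (2.40)
[cite: BenfattoGiulianiMastropietro2006].
-/

noncomputable section

namespace Summit.HubbardSuperconductivity.HubbardSuperconductivity.Theorems.PerturbedFermiCurve

set_option linter.dupNamespace false -- summit = problem name (single-conjunct summit), D-0017
set_option maxSynthPendingDepth 4 -- nested operator-norm instances (up to fourth Fréchet derivatives)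

open Real Set
open Literature.MathematicalPhysics.QuantumLattice Literature.MathematicalPhysics.QuantumLattice.BandSectorCounting
open Summit.HubbardSuperconductivity.HubbardSuperconductivity.Theorems.DispersionFlow
open Summit.HubbardSuperconductivity.HubbardSuperconductivity.Theorems.KLRegimeSplit

section Frame

variable {a b : ℝ} (B : BandBounds a b) {K : TrigPolyC4v} {A₀ A₁ A₂ A₃ : ℝ}
  (hA₀ : ∀ p : Momentum, ‖iteratedFDeriv ℝ 0 (frameShift K) p‖ ≤ A₀)
  (hA₁ : ∀ p : Momentum, ‖iteratedFDeriv ℝ 1 (frameShift K) p‖ ≤ A₁)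
  (hA₂ : ∀ p : Momentum, ‖iteratedFDeriv ℝ 2 (frameShift K) p‖ ≤ A₂)
  (hA₃ : ∀ p : Momentum, ‖iteratedFDeriv ℝ 3 (frameShift K) p‖ ≤ A₃)
  (hA₁Dt : 2 * A₁ < B.Dtmin) {ν : ℝ} (hlo : a ≤ ν - A₀) (hhi : ν + A₀ ≤ b)

/-- The free band `ε₀ + 0` read through the lineage's `pertBand` lemmas: its radial slope at the free Fermi point is `rayDispersionDt`. -/
theorem free_polarJac_eq (ν : ℝ) :
    (fun t : ℝ => bandFermiRadius ν t /
        fderiv ℝ (fun k : Fin 2 → ℝ => sqDispersion k + (0 : (Fin 2 → ℝ) → ℝ) k) (bandFermiRadius ν t • dir t) (dir t)) =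
      fun t : ℝ => bandFermiRadius ν t / rayDispersionDt t (bandFermiRadius ν t) := by
  funext t
  rw [fderiv_pertBand_apply_dir (δ := (0 : (Fin 2 → ℝ) → ℝ)) contDiff_const t (bandFermiRadius ν t)]
  simp

include B hA₀ hA₁ hA₂ hA₃ hA₁Dt hlo hhi in
/-- **THE FRAME'S POLAR JACOBIAN AGAINST THE FREE ONE, orders 0, 1, 2** (`jacPert`).  With the free sizes `U₀, R₁, R₂` and the radius
differences `W₁, W₂` at `θ` (and `W₀ = A₀/(Dt_min − 2A₁)`): the three differences are bounded by `…TwoFrameJacobian`'s closed forms at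
`ρ₀ = Dt_min − 2A₁`, `E₁ = 4+2A₁`, `E₂ = 4+4A₂`, `E₃ = 4+8A₃`, `Δ₁ = 4W₀+2A₁`, `Δ₂ = 4W₀+4A₂`, `Δ₃ = 4W₀+8A₃`, radius sizes `U₀+W₀`, `R₁+W₁`,
`R₂+W₂`. [cite: BenfattoGiulianiMastropietro2006, §2.4 Lemma 2.1 (2.40)] -/
theorem frame_polarJac_sub_free_le {θ U₀ R₁ R₂ W₁ W₂ : ℝ} (hU₀ : bandFermiRadius ν θ ≤ U₀) (hR₁ : |deriv (bandFermiRadius ν) θ| ≤ R₁)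
    (hR₂ : |deriv (deriv (bandFermiRadius ν)) θ| ≤ R₂)
    (hW₁ : |deriv (perturbedFermiRadius (fun p : Fin 2 → ℝ => -K.eval p) ν) θ - deriv (bandFermiRadius ν) θ| ≤ W₁)
    (hW₂ : |deriv (deriv (perturbedFermiRadius (fun p : Fin 2 → ℝ => -K.eval p) ν)) θ - deriv (deriv (bandFermiRadius ν)) θ| ≤ W₂) :
    |perturbedFermiRadius (fun p : Fin 2 → ℝ => -K.eval p) ν θ /
          fderiv ℝ (fun k : Fin 2 → ℝ => sqDispersion k + (fun p : Fin 2 → ℝ => -K.eval p) k)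
            (perturbedFermiRadius (fun p : Fin 2 → ℝ => -K.eval p) ν θ • dir θ) (dir θ) -
        bandFermiRadius ν θ / rayDispersionDt θ (bandFermiRadius ν θ)| ≤
      A₀ / (B.Dtmin - 2 * A₁) / (B.Dtmin - 2 * A₁) + U₀ * (4 * (A₀ / (B.Dtmin - 2 * A₁)) + 2 * A₁) / (B.Dtmin - 2 * A₁) ^ 2 ∧
    |deriv (fun t : ℝ => perturbedFermiRadius (fun p : Fin 2 → ℝ => -K.eval p) ν t /
          fderiv ℝ (fun k : Fin 2 → ℝ => sqDispersion k + (fun p : Fin 2 → ℝ => -K.eval p) k)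
            (perturbedFermiRadius (fun p : Fin 2 → ℝ => -K.eval p) ν t • dir t) (dir t)) θ -
        deriv (fun t : ℝ => bandFermiRadius ν t / rayDispersionDt t (bandFermiRadius ν t)) θ| ≤
      W₁ / (B.Dtmin - 2 * A₁) + (R₁ + W₁) * (4 * (A₀ / (B.Dtmin - 2 * A₁)) + 2 * A₁) / (B.Dtmin - 2 * A₁) ^ 2 +
        (((A₀ / (B.Dtmin - 2 * A₁)) * ((4 + 4 * A₂) * ((R₁ + W₁) + (U₀ + A₀ / (B.Dtmin - 2 * A₁))) + (4 + 2 * A₁)) + (U₀ + A₀ / (B.Dtmin - 2 * A₁)) * ((4 * (A₀ / (B.Dtmin - 2 * A₁)) + 4 * A₂) * ((R₁ + W₁) + (U₀ + A₀ / (B.Dtmin - 2 * A₁))) + (4 + 4 * A₂) * (W₁ + (A₀ / (B.Dtmin - 2 * A₁))) + (4 * (A₀ / (B.Dtmin - 2 * A₁)) + 2 * A₁))) / (B.Dtmin - 2 * A₁) ^ 2 +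
          2 * ((U₀ + A₀ / (B.Dtmin - 2 * A₁)) * ((4 + 4 * A₂) * ((R₁ + W₁) + (U₀ + A₀ / (B.Dtmin - 2 * A₁))) + (4 + 2 * A₁))) * (4 * (A₀ / (B.Dtmin - 2 * A₁)) + 2 * A₁) / (B.Dtmin - 2 * A₁) ^ 3) ∧
    |deriv (deriv (fun t : ℝ => perturbedFermiRadius (fun p : Fin 2 → ℝ => -K.eval p) ν t /
          fderiv ℝ (fun k : Fin 2 → ℝ => sqDispersion k + (fun p : Fin 2 → ℝ => -K.eval p) k)
            (perturbedFermiRadius (fun p : Fin 2 → ℝ => -K.eval p) ν t • dir t) (dir t))) θ -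
        deriv (deriv (fun t : ℝ => bandFermiRadius ν t / rayDispersionDt t (bandFermiRadius ν t))) θ| ≤
      (W₂ / (B.Dtmin - 2 * A₁) + (R₂ + W₂) * (4 * (A₀ / (B.Dtmin - 2 * A₁)) + 2 * A₁) / (B.Dtmin - 2 * A₁) ^ 2) +
        (((A₀ / (B.Dtmin - 2 * A₁)) * ((4 + 8 * A₃) * ((R₁ + W₁) + (U₀ + A₀ / (B.Dtmin - 2 * A₁))) ^ 2 + (4 + 4 * A₂) * ((R₂ + W₂) + 2 * (R₁ + W₁) + (U₀ + A₀ / (B.Dtmin - 2 * A₁))) + 2 * ((4 + 4 * A₂) * ((R₁ + W₁) + (U₀ + A₀ / (B.Dtmin - 2 * A₁)))) + (4 + 2 * A₁)) +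
              (U₀ + A₀ / (B.Dtmin - 2 * A₁)) * ((4 * (A₀ / (B.Dtmin - 2 * A₁)) + 8 * A₃) * ((R₁ + W₁) + (U₀ + A₀ / (B.Dtmin - 2 * A₁))) ^ 2 + 2 * (4 + 8 * A₃) * ((R₁ + W₁) + (U₀ + A₀ / (B.Dtmin - 2 * A₁))) * (W₁ + (A₀ / (B.Dtmin - 2 * A₁))) + (4 * (A₀ / (B.Dtmin - 2 * A₁)) + 4 * A₂) * ((R₂ + W₂) + (U₀ + A₀ / (B.Dtmin - 2 * A₁)) + 2 * (R₁ + W₁)) + (4 + 4 * A₂) * (W₂ + 2 * W₁ + (A₀ / (B.Dtmin - 2 * A₁))) +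
                2 * ((4 * (A₀ / (B.Dtmin - 2 * A₁)) + 4 * A₂) * ((R₁ + W₁) + (U₀ + A₀ / (B.Dtmin - 2 * A₁))) + (4 + 4 * A₂) * (W₁ + (A₀ / (B.Dtmin - 2 * A₁)))) + (4 * (A₀ / (B.Dtmin - 2 * A₁)) + 2 * A₁))) / (B.Dtmin - 2 * A₁) ^ 2 +
          2 * ((U₀ + A₀ / (B.Dtmin - 2 * A₁)) * ((4 + 8 * A₃) * ((R₁ + W₁) + (U₀ + A₀ / (B.Dtmin - 2 * A₁))) ^ 2 + (4 + 4 * A₂) * ((R₂ + W₂) + 2 * (R₁ + W₁) + (U₀ + A₀ / (B.Dtmin - 2 * A₁))) + 2 * ((4 + 4 * A₂) * ((R₁ + W₁) + (U₀ + A₀ / (B.Dtmin - 2 * A₁)))) + (4 + 2 * A₁))) * (4 * (A₀ / (B.Dtmin - 2 * A₁)) + 2 * A₁) / (B.Dtmin - 2 * A₁) ^ 3) +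
        2 * ((W₁ * ((4 + 4 * A₂) * ((R₁ + W₁) + (U₀ + A₀ / (B.Dtmin - 2 * A₁))) + (4 + 2 * A₁)) + (R₁ + W₁) * ((4 * (A₀ / (B.Dtmin - 2 * A₁)) + 4 * A₂) * ((R₁ + W₁) + (U₀ + A₀ / (B.Dtmin - 2 * A₁))) + (4 + 4 * A₂) * (W₁ + (A₀ / (B.Dtmin - 2 * A₁))) + (4 * (A₀ / (B.Dtmin - 2 * A₁)) + 2 * A₁))) / (B.Dtmin - 2 * A₁) ^ 2 +
          2 * ((R₁ + W₁) * ((4 + 4 * A₂) * ((R₁ + W₁) + (U₀ + A₀ / (B.Dtmin - 2 * A₁))) + (4 + 2 * A₁))) * (4 * (A₀ / (B.Dtmin - 2 * A₁)) + 2 * A₁) / (B.Dtmin - 2 * A₁) ^ 3) +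
        2 * (((A₀ / (B.Dtmin - 2 * A₁)) * ((4 + 4 * A₂) * ((R₁ + W₁) + (U₀ + A₀ / (B.Dtmin - 2 * A₁))) + (4 + 2 * A₁)) ^ 2 + 2 * ((U₀ + A₀ / (B.Dtmin - 2 * A₁)) * ((4 + 4 * A₂) * ((R₁ + W₁) + (U₀ + A₀ / (B.Dtmin - 2 * A₁))) + (4 + 2 * A₁))) * ((4 * (A₀ / (B.Dtmin - 2 * A₁)) + 4 * A₂) * ((R₁ + W₁) + (U₀ + A₀ / (B.Dtmin - 2 * A₁))) + (4 + 4 * A₂) * (W₁ + (A₀ / (B.Dtmin - 2 * A₁))) + (4 * (A₀ / (B.Dtmin - 2 * A₁)) + 2 * A₁))) / (B.Dtmin - 2 * A₁) ^ 3 +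
          3 * ((U₀ + A₀ / (B.Dtmin - 2 * A₁)) * ((4 + 4 * A₂) * ((R₁ + W₁) + (U₀ + A₀ / (B.Dtmin - 2 * A₁))) + (4 + 2 * A₁)) ^ 2) * (4 * (A₀ / (B.Dtmin - 2 * A₁)) + 2 * A₁) / (B.Dtmin - 2 * A₁) ^ 4) := by
  have hA0 : 0 ≤ A₀ := le_trans (norm_nonneg _) (hA₀ 0)
  have hA1 : 0 ≤ A₁ := le_trans (norm_nonneg _) (hA₁ 0)
  have hA2 : 0 ≤ A₂ := le_trans (norm_nonneg _) (hA₂ 0)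
  have hA3 : 0 ≤ A₃ := le_trans (norm_nonneg _) (hA₃ 0)
  -- the lineage's data for `δ = 0` and `δ′ = −K`
  have hδs : ContDiff ℝ 4 (0 : (Fin 2 → ℝ) → ℝ) := contDiff_const
  have hδs' : ContDiff ℝ 4 (fun p : Fin 2 → ℝ => -K.eval p) := contDiff_four_negEval
  have hδ : ∀ k : Fin 2 → ℝ, (∀ i, |k i| ≤ π) → |(0 : (Fin 2 → ℝ) → ℝ) k| ≤ A₀ := fun k _ => by simpa using hA0
  have hδ' : ∀ k : Fin 2 → ℝ, (∀ i, |k i| ≤ π) → |(fun p : Fin 2 → ℝ => -K.eval p) k| ≤ A₀ := fun k _ => abs_negEval_le hA₀ k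
  have hκ : ∀ k : Fin 2 → ℝ, (∀ i, |k i| ≤ π) → ‖fderiv ℝ (0 : (Fin 2 → ℝ) → ℝ) k‖ ≤ 2 * A₁ := fun k _ => by simp; positivity
  have hκ' : ∀ k : Fin 2 → ℝ, (∀ i, |k i| ≤ π) → ‖fderiv ℝ (fun p : Fin 2 → ℝ => -K.eval p) k‖ ≤ 2 * A₁ :=
    fun k _ => norm_fderiv_negEval_le hA₁ k
  have hu := isBandFermiRadius_free B hA₀ hlo hhi
  have hv := isBandFermiRadius_frameRadius_perOrder B hA₀ hlo hhi
  have hE₀ : ∀ k : Fin 2 → ℝ, (∀ i, |k i| ≤ π) → |(fun p : Fin 2 → ℝ => -K.eval p) k - (0 : (Fin 2 → ℝ) → ℝ) k| ≤ A₀ :=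
    fun k _ => by simpa using abs_negEval_le hA₀ k
  have he := contDiff_pertBand hδs
  have he' := contDiff_pertBand hδs'
  have huC := contDiff_four_of_isRoot B hδs hδ hlo hhi hκ hA₁Dt hu
  have hvC := contDiff_four_of_isRoot B hδs' hδ' hlo hhi hκ' hA₁Dt hv
  have hρ0 : 0 < B.Dtmin - 2 * A₁ := sub_pos.2 hA₁Dt
  have hρ : ∀ ϑ, B.Dtmin - 2 * A₁ ≤
      fderiv ℝ (fun k : Fin 2 → ℝ => sqDispersion k + (0 : (Fin 2 → ℝ) → ℝ) k) (bandFermiRadius ν ϑ • dir ϑ) (dir ϑ) :=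
    fun ϑ => Dtmin_sub_le_fderiv_pertBand_dir B hδ hlo hhi hκ hu hδs ϑ
  have hρ' : ∀ ϑ, B.Dtmin - 2 * A₁ ≤ fderiv ℝ (fun k : Fin 2 → ℝ => sqDispersion k + (fun p : Fin 2 → ℝ => -K.eval p) k)
      (perturbedFermiRadius (fun p : Fin 2 → ℝ => -K.eval p) ν ϑ • dir ϑ) (dir ϑ) :=
    fun ϑ => Dtmin_sub_le_fderiv_pertBand_dir B hδ' hlo hhi hκ' hv hδs' ϑ
  -- sizes of the two bands at the two curve points
  have hE₁ := norm_fderiv_pertBand_le hδs hκ hu θ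
  have hE₁' := norm_fderiv_pertBand_le hδs' hκ' hv θ
  have hE₂ := norm_fderiv_two_pertBand_le hδs hu (κ₂ := 4 * A₂) (fun k _ => by simp; positivity) θ
  have hE₂' := norm_fderiv_two_pertBand_le hδs' hv (κ₂ := 4 * A₂) (fun k _ => norm_fderiv_two_negEval_le hA₂ k) θ
  have hE₃ := norm_fderiv_three_pertBand_le hδs hu (κ₃ := 8 * A₃) (fun k _ => by simp; positivity) θ
  have hE₃' := norm_fderiv_three_pertBand_le hδs' hv (κ₃ := 8 * A₃) (fun k _ => norm_fderiv_three_frameShift_le hA₃ k) θ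
  -- differences of the two bands' derivatives at the two curve points
  have hΔ₁ : ‖fderiv ℝ (fun k : Fin 2 → ℝ => sqDispersion k + (fun p : Fin 2 → ℝ => -K.eval p) k)
        (perturbedFermiRadius (fun p : Fin 2 → ℝ => -K.eval p) ν θ • dir θ) -
      fderiv ℝ (fun k : Fin 2 → ℝ => sqDispersion k + (0 : (Fin 2 → ℝ) → ℝ) k) (bandFermiRadius ν θ • dir θ)‖ ≤
      4 * (A₀ / (B.Dtmin - 2 * A₁)) + 2 * A₁ :=
    (norm_fderiv_two_roots_sub_le B hδs hδs' hδ hδ' hlo hhi hκ hA₁Dt hu hv hE₀ (κ₂ := 0) (E₁ := 2 * A₁) (fun k _ => by simp)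
      (fun k _ => by simpa using norm_fderiv_negEval_le hA₁ k) θ).trans (le_of_eq (by ring))
  have hΔ₂ : ‖fderiv ℝ (fderiv ℝ (fun k : Fin 2 → ℝ => sqDispersion k + (fun p : Fin 2 → ℝ => -K.eval p) k))
        (perturbedFermiRadius (fun p : Fin 2 → ℝ => -K.eval p) ν θ • dir θ) -
      fderiv ℝ (fderiv ℝ (fun k : Fin 2 → ℝ => sqDispersion k + (0 : (Fin 2 → ℝ) → ℝ) k)) (bandFermiRadius ν θ • dir θ)‖ ≤
      4 * (A₀ / (B.Dtmin - 2 * A₁)) + 4 * A₂ :=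
    (norm_fderiv_two_two_roots_sub_le B hδs hδs' hδ hδ' hlo hhi hκ hA₁Dt hu hv hE₀ (κ₃ := 0) (E₂ := 4 * A₂) (fun k _ => by simp)
      (fun k _ => by simpa using norm_fderiv_two_negEval_le hA₂ k) θ).trans (le_of_eq (by ring))
  have hΔ₃ : ‖fderiv ℝ (fderiv ℝ (fderiv ℝ (fun k : Fin 2 → ℝ => sqDispersion k + (fun p : Fin 2 → ℝ => -K.eval p) k)))
        (perturbedFermiRadius (fun p : Fin 2 → ℝ => -K.eval p) ν θ • dir θ) -
      fderiv ℝ (fderiv ℝ (fderiv ℝ (fun k : Fin 2 → ℝ => sqDispersion k + (0 : (Fin 2 → ℝ) → ℝ) k))) (bandFermiRadius ν θ • dir θ)‖ ≤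
      4 * (A₀ / (B.Dtmin - 2 * A₁)) + 8 * A₃ :=
    (norm_fderiv_three_two_roots_sub_le B hδs hδs' hδ hδ' hlo hhi hκ hA₁Dt hu hv hE₀ (κ₄ := 0) (E₃ := 8 * A₃) (fun k _ => by simp)
      (fun k _ => by simpa using norm_fderiv_three_frameShift_le hA₃ k) θ).trans (le_of_eq (by ring))
  -- radius sizes (free sharp + widths)
  obtain ⟨h4, h0⟩ := level_mem_band B hA₀ hlo hhi
  have hW₀ := abs_frameRadius_sub_bandFermiRadius_le B hA₀ hA₁ hA₁Dt hlo hhi θ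
  have hW0nn : 0 ≤ A₀ / (B.Dtmin - 2 * A₁) := div_nonneg hA0 hρ0.le
  have hUf : |bandFermiRadius ν θ| ≤ U₀ := by rw [abs_of_pos (bandFermiRadius_pos h4 h0 θ)]; exact hU₀
  have hUf' : |bandFermiRadius ν θ| ≤ U₀ + A₀ / (B.Dtmin - 2 * A₁) := hUf.trans (le_add_of_nonneg_right hW0nn)
  have hUv : |perturbedFermiRadius (fun p : Fin 2 → ℝ => -K.eval p) ν θ| ≤ U₀ + A₀ / (B.Dtmin - 2 * A₁) :=
    abs_le_add_of_abs_sub_le hUf hW₀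
  have hW1nn : 0 ≤ W₁ := (abs_nonneg _).trans hW₁
  have hW2nn : 0 ≤ W₂ := (abs_nonneg _).trans hW₂
  have hR₁f : |deriv (bandFermiRadius ν) θ| ≤ R₁ + W₁ := hR₁.trans (le_add_of_nonneg_right hW1nn)
  have hR₁v := abs_le_add_of_abs_sub_le hR₁ hW₁
  have hR₂f : |deriv (deriv (bandFermiRadius ν)) θ| ≤ R₂ + W₂ := hR₂.trans (le_add_of_nonneg_right hW2nn)
  have hR₂v := abs_le_add_of_abs_sub_le hR₂ hW₂
  refine ⟨?_, ?_, ?_⟩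
  · have h := abs_polarJac_sub_le hρ0 (hρ θ) (hρ' θ) hΔ₁ hUf hW₀
    rw [fderiv_pertBand_apply_dir hδs θ (bandFermiRadius ν θ)] at h
    simpa using h
  · have h := abs_deriv_polarJac_sub_le he he' huC hvC hρ0 (hρ θ) (hρ' θ) hE₁ hE₁' hE₂ hE₂' hΔ₁ hΔ₂ hUf' hUv hR₁f hR₁v hW₀ hW₁
    rw [free_polarJac_eq ν] at h
    exact h
  · have h := abs_deriv_two_polarJac_sub_le he he' huC hvC hρ0 hρ hρ' hE₁ hE₁' hE₂ hE₂' hE₃ hE₃' hΔ₁ hΔ₂ hΔ₃ hUf' hUv hR₁f hR₁v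
      hR₂f hR₂v hW₀ hW₁ hW₂
    rw [free_polarJac_eq ν] at h
    exact h

/-! ## §2 Keyed to a certified table: `|J_K^{(i)}(θ)| ≤ G_i + Γ_i` -/

include B hA₀ hA₁ hA₂ hA₃ hA₁Dt hlo hhi in
/-- **`hJjet` from a polar-jet table** (`jacCertG i + jacPert i`, `i ≤ 2`): under `FreeBandPolarJets a b T` (e.g. `KlwjCertA`), for the frame `K`
and numbers `W₁, W₂` dominating the order-1/2 radius widths of `…WindowJets` (at `R₁′ = T.R1 + W₁`), at every angle:
`|J_K(θ)| ≤ T.G0 + Γ₀`, `|J_K′(θ)| ≤ T.G1 + Γ₁`, `|J_K″(θ)| ≤ T.G2 + Γ₂`, the `Γ`'s being `frame_polarJac_sub_free_le`'s closed forms at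
`U₀ = T.umax`, `R₁ = T.R1`, `R₂ = T.R2`. -/
theorem frame_polarJac_le_of_polarJets {T : PolarJetTable} (h : FreeBandPolarJets a b T) {W₁ W₂ : ℝ}
    (hW₁ : ((4 + 2 * A₁) * (A₀ / (B.Dtmin - 2 * A₁)) +
        (π * Real.sqrt 2 + (4 + 2 * A₁) * (π * Real.sqrt 2) / (B.Dtmin - 2 * A₁)) * ((4 + 0) * (A₀ / (B.Dtmin - 2 * A₁)) + 2 * A₁)) /
        (B.Dtmin - 2 * A₁) ≤ W₁)
    (hW₂ : A₀ / (B.Dtmin - 2 * A₁) +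
        (((4 + 0) * (A₀ / (B.Dtmin - 2 * A₁)) + 4 * A₂) * ((T.R1 + W₁) + π * Real.sqrt 2) ^ 2 +
          2 * (4 + 0) * ((T.R1 + W₁) + π * Real.sqrt 2) * (W₁ + A₀ / (B.Dtmin - 2 * A₁)) +
          ((4 + 0) * (A₀ / (B.Dtmin - 2 * A₁)) + 2 * A₁) * (2 * (T.R1 + W₁) + π * Real.sqrt 2) +
          (4 + 2 * A₁) * (A₀ / (B.Dtmin - 2 * A₁) + 2 * W₁) +
          (T.R2 + π * Real.sqrt 2) * ((4 + 0) * (A₀ / (B.Dtmin - 2 * A₁)) + 2 * A₁)) / (B.Dtmin - 2 * A₁) ≤ W₂)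
    (θ : ℝ) :
    |perturbedFermiRadius (fun p : Fin 2 → ℝ => -K.eval p) ν θ /
          fderiv ℝ (fun k : Fin 2 → ℝ => sqDispersion k + (fun p : Fin 2 → ℝ => -K.eval p) k)
            (perturbedFermiRadius (fun p : Fin 2 → ℝ => -K.eval p) ν θ • dir θ) (dir θ)| ≤
      T.G0 + (A₀ / (B.Dtmin - 2 * A₁) / (B.Dtmin - 2 * A₁) + T.umax * (4 * (A₀ / (B.Dtmin - 2 * A₁)) + 2 * A₁) / (B.Dtmin - 2 * A₁) ^ 2) ∧
    |deriv (fun t : ℝ => perturbedFermiRadius (fun p : Fin 2 → ℝ => -K.eval p) ν t /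
          fderiv ℝ (fun k : Fin 2 → ℝ => sqDispersion k + (fun p : Fin 2 → ℝ => -K.eval p) k)
            (perturbedFermiRadius (fun p : Fin 2 → ℝ => -K.eval p) ν t • dir t) (dir t)) θ| ≤
      T.G1 + (W₁ / (B.Dtmin - 2 * A₁) + (T.R1 + W₁) * (4 * (A₀ / (B.Dtmin - 2 * A₁)) + 2 * A₁) / (B.Dtmin - 2 * A₁) ^ 2 +
        (((A₀ / (B.Dtmin - 2 * A₁)) * ((4 + 4 * A₂) * ((T.R1 + W₁) + (T.umax + A₀ / (B.Dtmin - 2 * A₁))) + (4 + 2 * A₁)) + (T.umax + A₀ / (B.Dtmin - 2 * A₁)) * ((4 * (A₀ / (B.Dtmin - 2 * A₁)) + 4 * A₂) * ((T.R1 + W₁) + (T.umax + A₀ / (B.Dtmin - 2 * A₁))) + (4 + 4 * A₂) * (W₁ + (A₀ / (B.Dtmin - 2 * A₁))) + (4 * (A₀ / (B.Dtmin - 2 * A₁)) + 2 * A₁))) / (B.Dtmin - 2 * A₁) ^ 2 +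
          2 * ((T.umax + A₀ / (B.Dtmin - 2 * A₁)) * ((4 + 4 * A₂) * ((T.R1 + W₁) + (T.umax + A₀ / (B.Dtmin - 2 * A₁))) + (4 + 2 * A₁))) * (4 * (A₀ / (B.Dtmin - 2 * A₁)) + 2 * A₁) / (B.Dtmin - 2 * A₁) ^ 3)) ∧
    |deriv (deriv (fun t : ℝ => perturbedFermiRadius (fun p : Fin 2 → ℝ => -K.eval p) ν t /
          fderiv ℝ (fun k : Fin 2 → ℝ => sqDispersion k + (fun p : Fin 2 → ℝ => -K.eval p) k)
            (perturbedFermiRadius (fun p : Fin 2 → ℝ => -K.eval p) ν t • dir t) (dir t))) θ| ≤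
      T.G2 + ((W₂ / (B.Dtmin - 2 * A₁) + (T.R2 + W₂) * (4 * (A₀ / (B.Dtmin - 2 * A₁)) + 2 * A₁) / (B.Dtmin - 2 * A₁) ^ 2) +
        (((A₀ / (B.Dtmin - 2 * A₁)) * ((4 + 8 * A₃) * ((T.R1 + W₁) + (T.umax + A₀ / (B.Dtmin - 2 * A₁))) ^ 2 + (4 + 4 * A₂) * ((T.R2 + W₂) + 2 * (T.R1 + W₁) + (T.umax + A₀ / (B.Dtmin - 2 * A₁))) + 2 * ((4 + 4 * A₂) * ((T.R1 + W₁) + (T.umax + A₀ / (B.Dtmin - 2 * A₁)))) + (4 + 2 * A₁)) +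
              (T.umax + A₀ / (B.Dtmin - 2 * A₁)) * ((4 * (A₀ / (B.Dtmin - 2 * A₁)) + 8 * A₃) * ((T.R1 + W₁) + (T.umax + A₀ / (B.Dtmin - 2 * A₁))) ^ 2 + 2 * (4 + 8 * A₃) * ((T.R1 + W₁) + (T.umax + A₀ / (B.Dtmin - 2 * A₁))) * (W₁ + (A₀ / (B.Dtmin - 2 * A₁))) + (4 * (A₀ / (B.Dtmin - 2 * A₁)) + 4 * A₂) * ((T.R2 + W₂) + (T.umax + A₀ / (B.Dtmin - 2 * A₁)) + 2 * (T.R1 + W₁)) + (4 + 4 * A₂) * (W₂ + 2 * W₁ + (A₀ / (B.Dtmin - 2 * A₁))) +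
                2 * ((4 * (A₀ / (B.Dtmin - 2 * A₁)) + 4 * A₂) * ((T.R1 + W₁) + (T.umax + A₀ / (B.Dtmin - 2 * A₁))) + (4 + 4 * A₂) * (W₁ + (A₀ / (B.Dtmin - 2 * A₁)))) + (4 * (A₀ / (B.Dtmin - 2 * A₁)) + 2 * A₁))) / (B.Dtmin - 2 * A₁) ^ 2 +
          2 * ((T.umax + A₀ / (B.Dtmin - 2 * A₁)) * ((4 + 8 * A₃) * ((T.R1 + W₁) + (T.umax + A₀ / (B.Dtmin - 2 * A₁))) ^ 2 + (4 + 4 * A₂) * ((T.R2 + W₂) + 2 * (T.R1 + W₁) + (T.umax + A₀ / (B.Dtmin - 2 * A₁))) + 2 * ((4 + 4 * A₂) * ((T.R1 + W₁) + (T.umax + A₀ / (B.Dtmin - 2 * A₁)))) + (4 + 2 * A₁))) * (4 * (A₀ / (B.Dtmin - 2 * A₁)) + 2 * A₁) / (B.Dtmin - 2 * A₁) ^ 3) +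
        2 * ((W₁ * ((4 + 4 * A₂) * ((T.R1 + W₁) + (T.umax + A₀ / (B.Dtmin - 2 * A₁))) + (4 + 2 * A₁)) + (T.R1 + W₁) * ((4 * (A₀ / (B.Dtmin - 2 * A₁)) + 4 * A₂) * ((T.R1 + W₁) + (T.umax + A₀ / (B.Dtmin - 2 * A₁))) + (4 + 4 * A₂) * (W₁ + (A₀ / (B.Dtmin - 2 * A₁))) + (4 * (A₀ / (B.Dtmin - 2 * A₁)) + 2 * A₁))) / (B.Dtmin - 2 * A₁) ^ 2 +
          2 * ((T.R1 + W₁) * ((4 + 4 * A₂) * ((T.R1 + W₁) + (T.umax + A₀ / (B.Dtmin - 2 * A₁))) + (4 + 2 * A₁))) * (4 * (A₀ / (B.Dtmin - 2 * A₁)) + 2 * A₁) / (B.Dtmin - 2 * A₁) ^ 3) +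
        2 * (((A₀ / (B.Dtmin - 2 * A₁)) * ((4 + 4 * A₂) * ((T.R1 + W₁) + (T.umax + A₀ / (B.Dtmin - 2 * A₁))) + (4 + 2 * A₁)) ^ 2 + 2 * ((T.umax + A₀ / (B.Dtmin - 2 * A₁)) * ((4 + 4 * A₂) * ((T.R1 + W₁) + (T.umax + A₀ / (B.Dtmin - 2 * A₁))) + (4 + 2 * A₁))) * ((4 * (A₀ / (B.Dtmin - 2 * A₁)) + 4 * A₂) * ((T.R1 + W₁) + (T.umax + A₀ / (B.Dtmin - 2 * A₁))) + (4 + 4 * A₂) * (W₁ + (A₀ / (B.Dtmin - 2 * A₁))) + (4 * (A₀ / (B.Dtmin - 2 * A₁)) + 2 * A₁))) / (B.Dtmin - 2 * A₁) ^ 3 +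
          3 * ((T.umax + A₀ / (B.Dtmin - 2 * A₁)) * ((4 + 4 * A₂) * ((T.R1 + W₁) + (T.umax + A₀ / (B.Dtmin - 2 * A₁))) + (4 + 2 * A₁)) ^ 2) * (4 * (A₀ / (B.Dtmin - 2 * A₁)) + 2 * A₁) / (B.Dtmin - 2 * A₁) ^ 4)) := by
  have hν : ν ∈ Icc a b := ⟨by linarith [le_trans (norm_nonneg _) (hA₀ 0)], by linarith [le_trans (norm_nonneg _) (hA₀ 0)]⟩
  have d1 := (abs_deriv_frameRadius_sub_bandFermiRadius_le B hA₀ hA₁ hA₁Dt hlo hhi θ).trans hW₁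
  have f1 := h.abs_deriv_le ν hν θ
  have f1w : |deriv (bandFermiRadius ν) θ| ≤ T.R1 + W₁ := f1.trans (le_add_of_nonneg_right ((abs_nonneg _).trans d1))
  have r1 := abs_le_add_of_abs_sub_le f1 d1
  have d2 := (abs_deriv_two_frameRadius_sub_bandFermiRadius_le B hA₀ hA₁ hA₂ hA₁Dt hlo hhi f1w r1 (h.abs_deriv_two_le ν hν θ) d1).trans
    hW₂
  obtain ⟨j0, j1, j2⟩ := frame_polarJac_sub_free_le B hA₀ hA₁ hA₂ hA₃ hA₁Dt hlo hhi (h.le_umax ν hν θ) f1 (h.abs_deriv_two_le ν hν θ) d1 d2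
  obtain ⟨g0, g1, g2⟩ := h.abs_polarJac_le ν hν θ
  exact ⟨abs_le_add_of_abs_sub_le g0 j0, abs_le_add_of_abs_sub_le g1 j1, abs_le_add_of_abs_sub_le g2 j2⟩

end Frame

end Summit.HubbardSuperconductivity.HubbardSuperconductivity.Theorems.PerturbedFermiCurve

end
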